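import Mathlib
import Literature.Analysis.UnboundedOperators.HeatKernel
import Literature.Analysis.FluidPDE.SpaceTimeRescaling
import Literature.Analysis.FluidPDE.SelfSimilarProofs
import HarnessLib

/-!
# Crux `RecurrentLiouville` (stmt-NavierStokesRegularity-1589), line `Sketch` (skeleton v6) — stub
# `stub_gkWeightedTransport`: weighted transport along the scaling flow

Theorems-only file (no definitions, no named facts), pure measure theory.  For `F ≥ 0` continuous
on the open backward slab `(-∞, 0) × ℝ³`, `t₀ < 0` and `1 ≤ c`, `c² ≤ 2`,

`∫_{(2t₀,t₀)×ℝ³} (∫_{[1,c]} F(ς²t, ςx) dς) K(−t,x) d(t,x) ≤ (c−1) ∫_{(4t₀,t₀)×ℝ³} F(τ,y) K(−τ,y) d(τ,y)`,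

`K` the Gauss–Weierstrass kernel (`stub_gkWeightedTransport`).  Proof: Tonelli
(`MeasureTheory.lintegral_lintegral_swap`; the integrand is a.e.-measurable on the product because
`F ∘ (ς, t, x) ↦ (ς²t, ςx)` is continuous on the measurable integration set, which is mapped into
the slab, and the weight is measurable), then for each fixed `ς ∈ [1, c]` the parabolic
self-similarity of the Gaussian `K(−t, x) = ς³ K(−ς²t, ςx)`
(`Literature.Analysis.FluidPDE.heatKernel_sq_mul_smul`), the linear change of variables
`(τ, y) = (ς²t, ςx)` with Jacobian `ς⁵`
(`Literature.Analysis.FluidPDE.setLIntegral_preimage_comp_stAffine`), `ς⁻² ≤ 1` and the window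
inclusion `(2ς²t₀, ς²t₀) ⊆ (4t₀, t₀)`; finally `volume [1, c] = c − 1`.

## References

* Y. Giga, R. V. Kohn, Comm. Pure Appl. Math. 38 (1985) 297–319 (weighted energies for the
  backward self-similar variables). [folklore]
-/

noncomputable section

-- the sub-problem namespace repeats the summit name (D-0017 layout `Summit.<S>.<P>.Theorems`)
set_option linter.dupNamespace false

namespace Summit.NavierStokesRegularity.NavierStokesRegularity.Theorems

open MeasureTheory Set Function Filter Topology TopologicalSpace Metric
open Literature.Analysis Literature.Analysis.FluidPDE
open scoped NNReal ENNReal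

/-- The backward Gaussian weight `(t, x) ↦ K(−t, x)` (as an `ℝ≥0∞`-valued function on
`ℝ × ℝ³`) is measurable. [folklore] -/
theorem gkTransport_measurable_kernel :
    Measurable fun z : ℝ × EuclideanSpace ℝ (Fin 3) =>
      ENNReal.ofReal (UnboundedOperators.heatKernel (-z.1) z.2) := by
  unfold UnboundedOperators.heatKernel
  fun_prop

/-- Parabolic self-similarity of the backward Gaussian weight in `ℝ≥0∞` form: for `0 < ς` and
`t < 0`, `K(−t, x) = ς³ K(−ς²t, ςx)` on `ℝ³`. [folklore] -/
theorem gkTransport_kernel_selfSimilar {ς : ℝ} (hς : 0 < ς) {z : ℝ × EuclideanSpace ℝ (Fin 3)}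
    (hz : z.1 < 0) :
    ENNReal.ofReal (UnboundedOperators.heatKernel (-z.1) z.2) =
      ENNReal.ofReal (ς ^ 3) *
        ENNReal.ofReal (UnboundedOperators.heatKernel (-(ς ^ 2 * z.1)) (ς • z.2)) := by
  have h := heatKernel_sq_mul_smul hς (neg_pos.mpr hz) z.2
  rw [finrank_euclideanSpace_fin] at h
  rw [← ENNReal.ofReal_mul (by positivity), show -(ς ^ 2 * z.1) = ς ^ 2 * (-z.1) by ring, h,
    ← mul_assoc, mul_inv_cancel₀ (by positivity), one_mul]

/-- The parabolic dilation `(t, x) ↦ (ς²t, ςx)` (`ς ≠ 0`) pulls the window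
`(ς²a, ς²b) × ℝ³` back to `(a, b) × ℝ³`. [folklore] -/
theorem gkTransport_preimage {ς : ℝ} (hς : 0 < ς) (a b : ℝ) :
    stAffine (ς ^ 2) ς 0 (0 : EuclideanSpace ℝ (Fin 3)) ⁻¹'
        (Ioo (ς ^ 2 * a) (ς ^ 2 * b) ×ˢ (univ : Set (EuclideanSpace ℝ (Fin 3)))) =
      Ioo a b ×ˢ (univ : Set (EuclideanSpace ℝ (Fin 3))) := by
  have h2 : (0 : ℝ) < ς ^ 2 := by positivity
  ext ⟨s, y⟩
  simp [mul_lt_mul_iff_right₀ h2]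

/-- **Transport of one slice.**  For a weight `K ≥ 0` on `ℝ × ℝ³` with the parabolic
self-similarity `K(t, x) = ς³ K(ς²t, ςx)` (`t < 0`), `t₀ < 0`, `c² ≤ 2` and `ς ∈ [1, c]`:
`∫_{(2t₀,t₀)×ℝ³} F(ς²t, ςx) K(t,x) ≤ ∫_{(4t₀,t₀)×ℝ³} F K` — the change of variables
`(τ, y) = (ς²t, ςx)` (Jacobian `ς⁵`), `ς⁻² ≤ 1` and `(2ς²t₀, ς²t₀) ⊆ (4t₀, t₀)`. [folklore] -/
theorem gkTransport_slice_le (F K : ℝ × EuclideanSpace ℝ (Fin 3) → ℝ≥0∞) {t₀ : ℝ} (ht₀ : t₀ < 0)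
    {c ς : ℝ} (hc2 : c ^ 2 ≤ 2) (hς : ς ∈ Icc (1 : ℝ) c)
    (hK : ∀ z : ℝ × EuclideanSpace ℝ (Fin 3), z.1 < 0 →
      K z = ENNReal.ofReal (ς ^ 3) * K (ς ^ 2 * z.1, ς • z.2)) :
    ∫⁻ z in Ioo (2 * t₀) t₀ ×ˢ (univ : Set (EuclideanSpace ℝ (Fin 3))),
        F (ς ^ 2 * z.1, ς • z.2) * K z ≤
      ∫⁻ z in Ioo (4 * t₀) t₀ ×ˢ (univ : Set (EuclideanSpace ℝ (Fin 3))), F z * K z := by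
  have hς0 : 0 < ς := one_pos.trans_le hς.1
  have hς1 : (1 : ℝ) ≤ ς ^ 2 := by nlinarith [hς.1]
  have hς2 : ς ^ 2 ≤ 2 := (pow_le_pow_left₀ hς0.le hς.2 2).trans hc2
  have hW : MeasurableSet (Ioo (2 * t₀) t₀ ×ˢ (univ : Set (EuclideanSpace ℝ (Fin 3)))) :=
    measurableSet_Ioo.prod MeasurableSet.univ
  have hlo : 4 * t₀ ≤ ς ^ 2 * (2 * t₀) := by
    nlinarith [mul_nonneg (sub_nonneg.mpr hς2) (neg_nonneg.mpr ht₀.le)]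
  have hhi : ς ^ 2 * t₀ ≤ t₀ := by
    nlinarith [mul_nonneg (sub_nonneg.mpr hς1) (neg_nonneg.mpr ht₀.le)]
  calc ∫⁻ z in Ioo (2 * t₀) t₀ ×ˢ (univ : Set (EuclideanSpace ℝ (Fin 3))),
          F (ς ^ 2 * z.1, ς • z.2) * K z
      = ∫⁻ z in Ioo (2 * t₀) t₀ ×ˢ (univ : Set (EuclideanSpace ℝ (Fin 3))),
          ENNReal.ofReal (ς ^ 3) * (F (ς ^ 2 * z.1, ς • z.2) * K (ς ^ 2 * z.1, ς • z.2)) := by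
        refine setLIntegral_congr_fun hW fun z hz => ?_
        rw [hK z (hz.1.2.trans ht₀)]
        ring
    _ = ENNReal.ofReal (ς ^ 3) *
          ∫⁻ z in Ioo (2 * t₀) t₀ ×ˢ (univ : Set (EuclideanSpace ℝ (Fin 3))),
            F (ς ^ 2 * z.1, ς • z.2) * K (ς ^ 2 * z.1, ς • z.2) :=
        lintegral_const_mul' _ _ ENNReal.ofReal_ne_top
    _ = ENNReal.ofReal (ς ^ 3) * (ENNReal.ofReal (ς ^ 2 * ς ^ 3)⁻¹ *
          ∫⁻ z in Ioo (ς ^ 2 * (2 * t₀)) (ς ^ 2 * t₀) ×ˢ (univ : Set (EuclideanSpace ℝ (Fin 3))),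
            F z * K z) := by
        congr 1
        have h := setLIntegral_preimage_comp_stAffine (E := EuclideanSpace ℝ (Fin 3))
          (pow_pos hς0 2) hς0 0 0 (fun z => F z * K z)
          (Ioo (ς ^ 2 * (2 * t₀)) (ς ^ 2 * t₀) ×ˢ univ)
        rw [gkTransport_preimage hς0, finrank_euclideanSpace_fin] at h
        simpa only [stAffine, zero_add] using h
    _ = ENNReal.ofReal (ς ^ 2)⁻¹ *
          ∫⁻ z in Ioo (ς ^ 2 * (2 * t₀)) (ς ^ 2 * t₀) ×ˢ (univ : Set (EuclideanSpace ℝ (Fin 3))),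
            F z * K z := by
        rw [← mul_assoc, ← ENNReal.ofReal_mul (by positivity)]
        congr 2
        field_simp
    _ ≤ 1 * ∫⁻ z in Ioo (4 * t₀) t₀ ×ˢ (univ : Set (EuclideanSpace ℝ (Fin 3))), F z * K z := by
        refine mul_le_mul' ?_ (lintegral_mono_set (prod_mono (Ioo_subset_Ioo hlo hhi) Subset.rfl))
        rw [← ENNReal.ofReal_one]
        exact ENNReal.ofReal_le_ofReal (inv_le_one_of_one_le₀ hς1)
    _ = _ := one_mul _

/-- **Weighted transport, abstract weight.**  For `F ≥ 0` continuous on the open backward slab, a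
measurable finite weight `K` with the parabolic self-similarity `K(t,x) = ς³ K(ς²t, ςx)`
(`t < 0`, `ς > 0`), `t₀ < 0` and `c² ≤ 2` (for `c < 1` both sides vanish):
`∫_{(2t₀,t₀)×ℝ³} (∫_{[1,c]} F(ς²t, ςx) dς) K ≤ (c − 1) ∫_{(4t₀,t₀)×ℝ³} F K` (Tonelli and
`gkTransport_slice_le` slice by slice). [folklore] -/
theorem gkTransport_weighted_le (F K : ℝ × EuclideanSpace ℝ (Fin 3) → ℝ≥0∞)
    (hF : ContinuousOn F (Iio (0 : ℝ) ×ˢ univ)) (hKm : Measurable K) (hKf : ∀ z, K z ≠ ∞)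
    (hK : ∀ ς : ℝ, 0 < ς → ∀ z : ℝ × EuclideanSpace ℝ (Fin 3), z.1 < 0 →
      K z = ENNReal.ofReal (ς ^ 3) * K (ς ^ 2 * z.1, ς • z.2))
    {t₀ : ℝ} (ht₀ : t₀ < 0) {c : ℝ} (hc2 : c ^ 2 ≤ 2) :
    ∫⁻ z in Ioo (2 * t₀) t₀ ×ˢ (univ : Set (EuclideanSpace ℝ (Fin 3))),
        (∫⁻ ς in Icc (1 : ℝ) c, F (ς ^ 2 * z.1, ς • z.2)) * K z ≤
      ENNReal.ofReal (c - 1) *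
        ∫⁻ z in Ioo (4 * t₀) t₀ ×ˢ (univ : Set (EuclideanSpace ℝ (Fin 3))), F z * K z := by
  have hmeas : AEMeasurable
      (uncurry fun (z : ℝ × EuclideanSpace ℝ (Fin 3)) (ς : ℝ) => F (ς ^ 2 * z.1, ς • z.2) * K z)
      ((volume.restrict (Ioo (2 * t₀) t₀ ×ˢ (univ : Set (EuclideanSpace ℝ (Fin 3))))).prod
        (volume.restrict (Icc (1 : ℝ) c))) := by
    rw [Measure.prod_restrict, ← Measure.volume_eq_prod]
    change AEMeasurable (fun p : (ℝ × EuclideanSpace ℝ (Fin 3)) × ℝ =>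
      F (p.2 ^ 2 * p.1.1, p.2 • p.1.2) * K p.1) _
    refine AEMeasurable.mul ?_ (hKm.comp measurable_fst).aemeasurable
    refine ContinuousOn.aemeasurable ?_
      ((measurableSet_Ioo.prod MeasurableSet.univ).prod measurableSet_Icc)
    refine hF.comp (by fun_prop : Continuous fun p : (ℝ × EuclideanSpace ℝ (Fin 3)) × ℝ =>
      (p.2 ^ 2 * p.1.1, p.2 • p.1.2)).continuousOn ?_
    rintro ⟨z, ς⟩ ⟨hz, hς⟩
    exact ⟨mul_neg_of_pos_of_neg (pow_pos (one_pos.trans_le hς.1) 2) (hz.1.2.trans ht₀),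
      mem_univ _⟩
  calc ∫⁻ z in Ioo (2 * t₀) t₀ ×ˢ (univ : Set (EuclideanSpace ℝ (Fin 3))),
          (∫⁻ ς in Icc (1 : ℝ) c, F (ς ^ 2 * z.1, ς • z.2)) * K z
      = ∫⁻ z in Ioo (2 * t₀) t₀ ×ˢ (univ : Set (EuclideanSpace ℝ (Fin 3))),
          ∫⁻ ς in Icc (1 : ℝ) c, F (ς ^ 2 * z.1, ς • z.2) * K z := by
        refine lintegral_congr fun z => ?_
        rw [lintegral_mul_const' _ _ (hKf z)]
    _ = ∫⁻ ς in Icc (1 : ℝ) c, ∫⁻ z in Ioo (2 * t₀) t₀ ×ˢ (univ : Set (EuclideanSpace ℝ (Fin 3))),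
          F (ς ^ 2 * z.1, ς • z.2) * K z :=
        lintegral_lintegral_swap hmeas
    _ ≤ ∫⁻ _ in Icc (1 : ℝ) c,
          ∫⁻ z in Ioo (4 * t₀) t₀ ×ˢ (univ : Set (EuclideanSpace ℝ (Fin 3))), F z * K z :=
        setLIntegral_mono' measurableSet_Icc fun ς hς =>
          gkTransport_slice_le F K ht₀ hc2 hς (hK ς (one_pos.trans_le hς.1))
    _ = ENNReal.ofReal (c - 1) *
          ∫⁻ z in Ioo (4 * t₀) t₀ ×ˢ (univ : Set (EuclideanSpace ℝ (Fin 3))), F z * K z := by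
        rw [setLIntegral_const, Real.volume_Icc, mul_comm]

/-- **Weighted transport along the scaling flow.**  For `F ≥ 0` continuous on the open slab,
`t₀ < 0` and `1 ≤ c`, `c² ≤ 2`:
`∫_{(2t₀,t₀)×ℝ³} (∫_{1}^{c} F(ς²t, ςx) dς) K(−t,x) ≤ (c−1) ∫_{(4t₀,t₀)×ℝ³} F(τ,y) K(−τ,y)`,
`K` the heat kernel: Tonelli, the substitution `(τ,y) = (ς²t, ςx)` (Jacobian `ς⁵`), the parabolic
self-similarity `K(−t,x) = ς³ K(−τ,y)` of the Gaussian, `ς^{-2} ≤ 1`, and `ς²·(2t₀,t₀) ⊆ (4t₀,t₀)`.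
[folklore] -/
theorem stub_gkWeightedTransport :
    ∀ (F : ℝ × EuclideanSpace ℝ (Fin 3) → ℝ≥0∞), ContinuousOn F (Iio (0 : ℝ) ×ˢ univ) →
      ∀ (t₀ : ℝ), t₀ < 0 → ∀ c : ℝ, 1 ≤ c → c ^ 2 ≤ 2 →
        ∫⁻ z in Ioo (2 * t₀) t₀ ×ˢ (univ : Set (EuclideanSpace ℝ (Fin 3))),
            (∫⁻ ς in Icc (1 : ℝ) c, F (ς ^ 2 * z.1, ς • z.2)) *
              ENNReal.ofReal (UnboundedOperators.heatKernel (-z.1) z.2) ≤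
          ENNReal.ofReal (c - 1) *
            ∫⁻ z in Ioo (4 * t₀) t₀ ×ˢ (univ : Set (EuclideanSpace ℝ (Fin 3))),
              F z * ENNReal.ofReal (UnboundedOperators.heatKernel (-z.1) z.2) := by
  intro F hF t₀ ht₀ c _ hc2
  exact gkTransport_weighted_le F
    (fun z => ENNReal.ofReal (UnboundedOperators.heatKernel (-z.1) z.2)) hF
    gkTransport_measurable_kernel (fun _ => ENNReal.ofReal_ne_top)
    (fun ς hς z hz => gkTransport_kernel_selfSimilar hς hz) ht₀ hc2

end Summit.NavierStokesRegularity.NavierStokesRegularity.Theorems
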